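/-
Copyright: literature formalisation for the harness. Statements follow the cited text.
-/
import Literature.AlgebraicGeometry.CossartPiltant200819.InertialCharacter2008
import Literature.AlgebraicGeometry.Resolution.DefectAmbient
import HarnessLib

/-!
# Cossart–Piltant I (2008), Thm 7.2 — `Kʳ/Kⁱ` is totally ramified (Zariski–Samuel VI §12 Thm 25)

Sequel to `InertialCharacter2008`. For `L/K` finite Galois and a valuation ring `W` of `L` whose
inertia group is ALL of `Gal(L/K)` (i.e. `K = Kⁱ`), with ramification group `G_r`, ramification
field `Kʳ = L^{G_r}` and value groups `Γ_K ≤ Γ_B ≤ Γ_{Kʳ}` inside `|L^×|_W`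
(`Resolution.valueSubgroup`), everything PROVED:

* `charOnValues` — for `σ ∈ G_i`, the character `Γ_{R} → κ(W)^×`, `v(y) ↦ χ_σ(y)` (well defined
  as `χ_σ(y)` depends only on `v(y)`), trivial on `Γ_K`; `charQuot` — its descent to
  `Γ_R/Γ_K`; `charHom` — **the homomorphism `G_i → Hom(Γ_{Kʳ}/Γ_K, κ^×)`** (Zariski–Samuel
  (15') "`φ : G_T → Hom(K*', Δ*')`" and (21) "an isomorphism of `G_T/G_V` into
  `Hom(Γ̃₀, Δ*')`"; the map (7) of [CossartPiltant2008], HAL p. 6, whose kernel "is" the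
  ramification group), with **kernel exactly `G_r`** (`charHom_ker`; the inclusion `ker ⊆ G_r`
  is the norm step of `InertialCharacter2008`);
* `index_ramificationGroup_le_relIndex` — **`(G_i : G_r) ≤ (Γ_{Kʳ} : Γ_K)`** (Dedekind's bound
  `#Hom(Q, κ^×) ≤ #Q`);
* `finrank_fixedField_eq_index` — `[L^H : K] = (G : H)`; `ramificationIndex_le_finrank` —
  `e ≤ [E : K]` (fundamental inequality, `Resolution.ValuationDefect`);
* `ramificationIndex_eq_finrank_of_le_fixedField` — **total ramification of `Kʳ/K` and of every
  layer `K ⊆ B ⊆ Kʳ`: `e(W ∩ B | K) = [B : K]`** (from `[Kʳ : K] = (G_i : G_r) ≤ e(Kʳ|K) =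
  e(B|K)·e(Kʳ|B)`, each factor at most the degree) — Zariski–Samuel VI §12 Thm 25 ("The groups
  `Γ̃₀` and `G_T/G_V` are isomorphic … Their orders `e₀` and `e′₀` are equal."), Cossart–Piltant
  2019, proof of Prop. 4.10 ("`Fʳ|Fⁱ` … is totally ramified"), and [CossartPiltant2008]: (8)
  `Gi/Gr ≃ Hom(WjL/VK, κ(Wj)^×)` (HAL p. 6), invoked in the proof of Thm 7.2 (HAL p. 20) as "by
  proposition 8.3 (2) (whose assumption is satisfied by (9))", i.e. `[L : K] = |WL/VK|` at every
  prime layer of `K₀ʳ/K₀ⁱ`.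

The base change `K ↦ B₁ ⊇ Kⁱ` and the discharge of `TameLayersTotallyRamified2008` follow in
`TameLayers2008`.

## Sources

* O. Zariski, P. Samuel, *Commutative Algebra* II (1960), Ch. VI §12 (pp. 67–82): (15'), (17),
  (21)–(23), Thm. 25 and its Corollary (p. 78). [ZariskiSamuel1960]
* V. Cossart, O. Piltant, J. Algebra 320 (2008), §3.2 (7)–(9) (HAL p. 6), proof of Thm 7.2
  (HAL p. 20), Prop. 8.3 (2) (HAL p. 23). [CossartPiltant2008]
-/

noncomputable section

namespace Literature.AlgebraicGeometry.CossartPiltant200819.CP2008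

open Literature.AlgebraicGeometry.Resolution IsLocalRing IntermediateField
open scoped Pointwise IntermediateField

universe u

section Rep

variable {K L : Type u} [Field K] [Field L] [Algebra K L]
  (W : ValuationSubring L) (R : IntermediateField K L)

/-- Every element of `Γ_R = v(R^×)` is the value of a non-zero element of `R`. [folklore] -/
theorem exists_eq_valuation_of_mem (γ : valueSubgroup R W) :
    ∃ y : L, y ∈ R ∧ y ≠ 0 ∧
      W.valuation y = ((γ : (ValuationSubring.ValueGroup W)ˣ) : ValuationSubring.ValueGroup W) := by
  obtain ⟨c, hc0, hc⟩ := (mem_valueSubgroup_iff R W _).mp γ.2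
  exact ⟨c, c.2, fun h => hc0 (Subtype.ext h), hc.symm⟩

/-- A chosen non-zero element of `R` of value `γ`. [folklore] -/
def rep (γ : valueSubgroup R W) : L := (exists_eq_valuation_of_mem W R γ).choose

/-- `rep γ ∈ R`. [folklore] -/
theorem rep_mem (γ : valueSubgroup R W) : rep W R γ ∈ R :=
  (exists_eq_valuation_of_mem W R γ).choose_spec.1

/-- `rep γ ≠ 0`. [folklore] -/
theorem rep_ne_zero (γ : valueSubgroup R W) : rep W R γ ≠ 0 :=
  (exists_eq_valuation_of_mem W R γ).choose_spec.2.1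

/-- `v(rep γ) = γ`. [folklore] -/
theorem valuation_rep (γ : valueSubgroup R W) :
    W.valuation (rep W R γ) =
      ((γ : (ValuationSubring.ValueGroup W)ˣ) : ValuationSubring.ValueGroup W) :=
  (exists_eq_valuation_of_mem W R γ).choose_spec.2.2

end Rep

section Values

variable {K L : Type u} [Field K] [Field L] [Algebra K L] [FiniteDimensional K L]
  (W : ValuationSubring L) (R : IntermediateField K L)

/-- **The character of `Γ_R` attached to `σ ∈ G_i`**: `v(y) ↦ χ_σ(y)` (well defined since
`χ_σ(y)` depends only on `v(y)`; multiplicative since `χ_σ` is).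
[cite: ZariskiSamuel1960, Ch. VI §12 (15')] -/
def charOnValues {σ : L ≃ₐ[K] L} (hσ : σ ∈ inertiaGroup W) :
    valueSubgroup R W →* (ResidueField W)ˣ where
  toFun γ := Units.mk0 (chi W σ hσ (rep W R γ)) (chi_ne_zero W hσ (rep_ne_zero W R γ))
  map_one' := by
    ext
    rw [Units.val_mk0, Units.val_one]
    exact chi_eq_one_of_valuation_eq_one W hσ
      (by rw [valuation_rep, OneMemClass.coe_one, Units.val_one])
  map_mul' γ δ := by
    ext
    rw [Units.val_mk0, Units.val_mul, Units.val_mk0, Units.val_mk0, ← map_mul]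
    refine chi_eq_of_valuation_eq W hσ (rep_ne_zero W R _) ?_
    rw [map_mul, valuation_rep, valuation_rep, valuation_rep, Subgroup.coe_mul, Units.val_mul]

/-- `charOnValues γ = χ_σ(y)` for ANY `y ≠ 0` of value `γ`. [folklore] -/
theorem charOnValues_apply {σ : L ≃ₐ[K] L} (hσ : σ ∈ inertiaGroup W) (γ : valueSubgroup R W)
    {y : L}
    (hv : W.valuation y =
      ((γ : (ValuationSubring.ValueGroup W)ˣ) : ValuationSubring.ValueGroup W)) :
    ((charOnValues W R hσ γ : (ResidueField W)ˣ) : ResidueField W) = chi W σ hσ y := by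
  change chi W σ hσ (rep W R γ) = _
  exact chi_eq_of_valuation_eq W hσ (rep_ne_zero W R γ) (by rw [valuation_rep, hv])

/-- The character is trivial on `Γ_K` (`σ` fixes `K`). [folklore] -/
theorem charOnValues_eq_one_of_mem {σ : L ≃ₐ[K] L} (hσ : σ ∈ inertiaGroup W)
    (γ : valueSubgroup R W) (hγ : (γ : (ValuationSubring.ValueGroup W)ˣ) ∈ valueSubgroup K W) :
    charOnValues W R hσ γ = 1 := by
  obtain ⟨c, hc0, hc⟩ := (mem_valueSubgroup_iff K W _).mp hγ
  ext
  rw [charOnValues_apply W R hσ γ hc.symm, Units.val_one]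
  exact chi_algebraMap W hσ hc0

/-- `Γ_K` as a subgroup of `Γ_R`. [folklore] -/
abbrev baseValues : Subgroup (valueSubgroup R W) :=
  (valueSubgroup K W).subgroupOf (valueSubgroup R W)

/-- `Γ_K ≤ ker`. [folklore] -/
theorem baseValues_le_ker {σ : L ≃ₐ[K] L} (hσ : σ ∈ inertiaGroup W) :
    baseValues W R ≤ (charOnValues W R hσ).ker := fun γ hγ => by
  rw [MonoidHom.mem_ker]
  exact charOnValues_eq_one_of_mem W R hσ γ (Subgroup.mem_subgroupOf.mp hγ)

/-- **The character of `Γ_R/Γ_K` attached to `σ ∈ G_i`.**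
[cite: ZariskiSamuel1960, Ch. VI §12 (15')] -/
def charQuot {σ : L ≃ₐ[K] L} (hσ : σ ∈ inertiaGroup W) :
    (valueSubgroup R W ⧸ baseValues W R) →* (ResidueField W)ˣ :=
  QuotientGroup.lift (baseValues W R) (charOnValues W R hσ) (baseValues_le_ker W R hσ)

/-- Value of `charQuot` on a class. [folklore] -/
theorem charQuot_mk {σ : L ≃ₐ[K] L} (hσ : σ ∈ inertiaGroup W) (γ : valueSubgroup R W) :
    charQuot W R hσ (γ : valueSubgroup R W ⧸ baseValues W R) = charOnValues W R hσ γ :=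
  QuotientGroup.lift_mk (baseValues W R) (baseValues_le_ker W R hσ) γ

/-- **Zariski–Samuel's homomorphism `φ : G_i → Hom(Γ_R/Γ_K, κ^×)`, `σ ↦ (v(y) ↦ χ_σ(y))`**
(for a valuation ring whose inertia group is all of `Gal(L/K)`; a homomorphism by
`χ_{στ} = χ_σ χ_τ`). [cite: ZariskiSamuel1960, Ch. VI §12 (15')] -/
def charHom (hi : ∀ σ : L ≃ₐ[K] L, σ ∈ inertiaGroup W) :
    (L ≃ₐ[K] L) →* ((valueSubgroup R W ⧸ baseValues W R) →* (ResidueField W)ˣ) where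
  toFun σ := charQuot W R (hi σ)
  map_one' := by
    refine MonoidHom.ext fun q => QuotientGroup.induction_on q fun γ => ?_
    rw [MonoidHom.one_apply, charQuot_mk]
    ext
    rw [charOnValues_apply W R (hi 1) γ (valuation_rep W R γ), Units.val_one]
    exact chi_eq_one_of_apply_eq W (hi 1) (rep_ne_zero W R γ) rfl
  map_mul' σ τ := by
    refine MonoidHom.ext fun q => QuotientGroup.induction_on q fun γ => ?_
    rw [MonoidHom.mul_apply, charQuot_mk, charQuot_mk, charQuot_mk]
    ext
    rw [Units.val_mul, charOnValues_apply W R (hi _) γ (valuation_rep W R γ),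
      charOnValues_apply W R (hi σ) γ (valuation_rep W R γ),
      charOnValues_apply W R (hi τ) γ (valuation_rep W R γ)]
    exact chi_mul_left W (hi σ) (hi τ) _

/-- Value of `charHom` on a class. [folklore] -/
theorem charHom_apply_mk (hi : ∀ σ : L ≃ₐ[K] L, σ ∈ inertiaGroup W) (σ : L ≃ₐ[K] L)
    (γ : valueSubgroup R W) :
    charHom W R hi σ (γ : valueSubgroup R W ⧸ baseValues W R) = charOnValues W R (hi σ) γ :=
  charQuot_mk W R (hi σ) γ

end Values

section Count

variable {K L : Type u} [Field K] [Field L] [Algebra K L] [FiniteDimensional K L]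
  (W : ValuationSubring L)

/-- **The kernel of `φ` is exactly `G_r`** (Zariski–Samuel: "the kernel of `φ` consists of those
elements `s` of `G_T` which satisfy the condition (17) … This subgroup is denoted by `G_V`";
[CossartPiltant2008] (7): "The ramification group is thus the kernel"; here `φ` lands in the
characters of `Γ_{Kʳ}/Γ_K`, so `⊇` is (17) and `⊆` is the norm step
`chi_eq_one_of_forall_mem_fixedField`).
[cite: ZariskiSamuel1960, Ch. VI §12 (17); CossartPiltant2008 §3.2 (7) (HAL p. 6)] -/
theorem charHom_ker (hi : ∀ σ : L ≃ₐ[K] L, σ ∈ inertiaGroup W) :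
    (charHom W (fixedField (ramificationGroup (K := K) W)) hi).ker =
      ramificationGroup (K := K) W := by
  ext σ
  rw [MonoidHom.mem_ker]
  constructor
  · intro h1
    refine mem_ramificationGroup_of_forall_mem_fixedField W (hi σ) fun y hy hy0 => ?_
    have hγ : Units.mk0 (W.valuation y) ((Valuation.ne_zero_iff _).mpr hy0) ∈
        valueSubgroup (fixedField (ramificationGroup (K := K) W)) W :=
      (mem_valueSubgroup_iff _ W _).mpr ⟨⟨y, hy⟩, fun h => hy0 (congrArg Subtype.val h), rfl⟩
    have h2 := DFunLike.congr_fun h1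
      ((⟨_, hγ⟩ : valueSubgroup (fixedField (ramificationGroup (K := K) W)) W) :
        valueSubgroup (fixedField (ramificationGroup (K := K) W)) W ⧸ baseValues W _)
    rw [charHom_apply_mk, MonoidHom.one_apply] at h2
    have h3 := congrArg Units.val h2
    rwa [charOnValues_apply W _ (hi σ) _ rfl, Units.val_one] at h3
  · intro hσ
    refine MonoidHom.ext fun q => QuotientGroup.induction_on q fun γ => ?_
    rw [MonoidHom.one_apply, charHom_apply_mk]
    ext
    rw [charOnValues_apply W _ (hi σ) γ (valuation_rep W _ γ), Units.val_one]
    exact (forall_chi_eq_one_iff W (hi σ)).mpr hσ _ (rep_ne_zero W _ γ)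

/-- Arithmetic: `a ≤ A`, `b ≤ B`, `0 < B` and `A·B ≤ a·b` force `a = A`. [folklore] -/
theorem eq_of_le_of_mul_le {a b A B : ℕ} (ha : a ≤ A) (hb : b ≤ B) (hB : 0 < B)
    (h : A * B ≤ a * b) : a = A := by
  refine le_antisymm ha ?_
  by_contra hlt
  rw [not_le] at hlt
  exact absurd h (not_le.mpr (lt_of_le_of_lt (Nat.mul_le_mul_left a hb)
    (mul_lt_mul_of_pos_right hlt hB)))

/-- **`e ≤ [E : K]`** for `E/K` finite and any valuation ring of `E` (fundamental inequality
`e·f ≤ n`, `Resolution.ramificationIndex_mul_inertiaDegree_le_finrank`, and `f ≥ 1`).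
[folklore] -/
theorem ramificationIndex_le_finrank (K : Type u) {E : Type u} [Field K] [Field E] [Algebra K E]
    [FiniteDimensional K E] (O : ValuationSubring E) :
    ramificationIndex K O ≤ Module.finrank K E := by
  obtain ⟨-, h2, h3⟩ := ramificationIndex_mul_inertiaDegree_le_finrank K O
  haveI := h2
  have hf : 0 < inertiaDegree K O := by
    unfold inertiaDegree
    exact Module.finrank_pos
  exact (Nat.le_mul_of_pos_right _ hf).trans h3

/-- `[L^H : K] = (Gal(L/K) : H)`. [folklore] -/
theorem finrank_fixedField_eq_index [IsGalois K L] (H : Subgroup (L ≃ₐ[K] L)) :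
    Module.finrank K (fixedField H) = H.index := by
  have h1 := Module.finrank_mul_finrank K (fixedField H) L
  rw [finrank_fixedField_eq_card, ← IsGalois.card_aut_eq_finrank K L, ← H.index_mul_card] at h1
  exact Nat.eq_of_mul_eq_mul_right Nat.card_pos h1

/-- **`(G_i : G_r) ≤ (Γ_{Kʳ} : Γ_K)`**: `G_i/G_r` embeds into `Hom(Γ_{Kʳ}/Γ_K, κ^×)`, which has
at most `(Γ_{Kʳ} : Γ_K)` elements (Zariski–Samuel (21): "an isomorphism of `G_T/G_V` into
`Hom(Γ̃₀, Δ*')`", and Thm 25). [cite: ZariskiSamuel1960, Ch. VI §12, (21) and Thm. 25] -/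
theorem index_ramificationGroup_le_relIndex (hi : ∀ σ : L ≃ₐ[K] L, σ ∈ inertiaGroup W) :
    (ramificationGroup (K := K) W).index ≤
      (valueSubgroup K W).relIndex
        (valueSubgroup (fixedField (ramificationGroup (K := K) W)) W) := by
  have hfin : (valueSubgroup K W).relIndex
      (valueSubgroup (fixedField (ramificationGroup (K := K) W)) W) ≠ 0 := by
    rw [← ramificationIndex_comap_eq_relIndex W K (fixedField (ramificationGroup (K := K) W))]
    haveI := (ramificationIndex_mul_inertiaDegree_le_finrank K
      (W.comap (algebraMap (fixedField (ramificationGroup (K := K) W)) L))).1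
    exact Subgroup.FiniteIndex.index_ne_zero
  haveI : (baseValues W (fixedField (ramificationGroup (K := K) W))).FiniteIndex := ⟨hfin⟩
  obtain ⟨hf, hcard⟩ := card_monoidHom_units_le
    (G := valueSubgroup (fixedField (ramificationGroup (K := K) W)) W ⧸
      baseValues W (fixedField (ramificationGroup (K := K) W))) (ResidueField W)
  haveI := hf
  have hk := Subgroup.index_ker (charHom W (fixedField (ramificationGroup (K := K) W)) hi)
  rw [charHom_ker W hi] at hk
  rw [hk]
  exact (Nat.card_le_card_of_injective _ Subtype.val_injective).trans hcard

/-- **Total ramification below `Kʳ` when `K = Kⁱ`** (Zariski–Samuel VI §12 Thm 25; CP 2019 proof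
of Prop. 4.10; [CossartPiltant2008] (8)–(9), HAL p. 6, and "proposition 8.3 (2) (whose assumption
is satisfied by (9))", HAL p. 20): for `L/K` finite Galois, `W` a valuation ring of `L` with
`G_i(W/V) = Gal(L/K)`, and `K ⊆ B ⊆ Kʳ = L^{G_r}`, `e(W ∩ B | W ∩ K) = [B : K]`.
[cite: ZariskiSamuel1960, Ch. VI §12, Thm. 25; CossartPiltant2008 §3.2 (8)–(9) (HAL p. 6)] -/
theorem ramificationIndex_eq_finrank_of_le_fixedField [IsGalois K L]
    (hi : ∀ σ : L ≃ₐ[K] L, σ ∈ inertiaGroup W) (B : IntermediateField K L)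
    (hB : B ≤ fixedField (ramificationGroup (K := K) W)) :
    ramificationIndex K (W.comap (algebraMap B L)) = Module.finrank K B := by
  -- notation-free: `R = Kʳ`, `Γ_K ≤ Γ_B ≤ Γ_R`
  have hKB : valueSubgroup K W ≤ valueSubgroup B W :=
    valueSubgroup_le_of_range_subset W (by
      rintro _ ⟨c, rfl⟩
      exact ⟨algebraMap K B c, (IsScalarTower.algebraMap_apply K B L c).symm⟩)
  have hBR : valueSubgroup B W ≤ valueSubgroup (fixedField (ramificationGroup (K := K) W)) W :=
    valueSubgroup_le_of_range_subset W (by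
      rintro _ ⟨b, rfl⟩
      exact ⟨⟨b, hB b.2⟩, rfl⟩)
  have hmul := Subgroup.relIndex_mul_relIndex (valueSubgroup K W) (valueSubgroup B W)
    (valueSubgroup (fixedField (ramificationGroup (K := K) W)) W) hKB hBR
  -- `e(B|K) ≤ [B : K]`
  have h1 : (valueSubgroup K W).relIndex (valueSubgroup B W) ≤ Module.finrank K B := by
    rw [← ramificationIndex_comap_eq_relIndex W K B]
    exact ramificationIndex_le_finrank K _
  -- `e(R|B) ≤ [R : B]`
  have h2 : (valueSubgroup B W).relIndex
      (valueSubgroup (fixedField (ramificationGroup (K := K) W)) W) ≤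
      relfinrank B (fixedField (ramificationGroup (K := K) W)) := by
    have hr : Set.range (algebraMap (extendScalars hB) L) =
        Set.range (algebraMap (fixedField (ramificationGroup (K := K) W)) L) := by
      ext x
      constructor
      · rintro ⟨y, rfl⟩
        exact ⟨⟨y, y.2⟩, rfl⟩
      · rintro ⟨y, rfl⟩
        exact ⟨⟨y, y.2⟩, rfl⟩
    rw [← valueSubgroup_eq_of_range_eq W hr, ← ramificationIndex_comap_eq_relIndex W B
      (extendScalars hB), relfinrank_eq_finrank_of_le hB]
    exact ramificationIndex_le_finrank B _
  -- `[R : K] ≤ e(R|K)`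
  have h3 : Module.finrank K (fixedField (ramificationGroup (K := K) W)) ≤
      (valueSubgroup K W).relIndex
        (valueSubgroup (fixedField (ramificationGroup (K := K) W)) W) := by
    rw [finrank_fixedField_eq_index]
    exact index_ramificationGroup_le_relIndex W hi
  have hdeg := finrank_bot_mul_relfinrank hB
  have hRpos : 0 < Module.finrank K (fixedField (ramificationGroup (K := K) W)) :=
    Module.finrank_pos
  have hb' : 0 < relfinrank B (fixedField (ramificationGroup (K := K) W)) :=
    Nat.pos_of_ne_zero fun h0 => by
      rw [h0, mul_zero] at hdeg
      omega
  have key : Module.finrank K B * relfinrank B (fixedField (ramificationGroup (K := K) W)) ≤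
      (valueSubgroup K W).relIndex (valueSubgroup B W) *
        (valueSubgroup B W).relIndex
          (valueSubgroup (fixedField (ramificationGroup (K := K) W)) W) := by
    rw [hmul, hdeg]
    exact h3
  rw [ramificationIndex_comap_eq_relIndex W K B]
  exact eq_of_le_of_mul_le h1 h2 hb' key

end Count

end Literature.AlgebraicGeometry.CossartPiltant200819.CP2008

end
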